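import Summits.QuantumFields.BalabanUV.T4Continuum.Support.NE7LandauExactSup
import Summits.QuantumFields.BalabanUV.T4Continuum.Support.NE7BlockMeanZeroSup
import Summits.QuantumFields.BalabanUV.T4Continuum.Support.NE7FlatHkOrthogonal
import Summits.QuantumFields.BalabanUV.T4Continuum.Support.NE7FlatHkCurlLetter
import Summits.QuantumFields.BalabanUV.T4Continuum.Support.NE7SliceGreenTestField
import Literature.MathematicalPhysics.QuantumFieldTheory.Balaban1983to89.B5Adjoint130
import Literature.MathematicalPhysics.QuantumFieldTheory.Balaban1983to89.B5Prop11G0Torus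
import HarnessLib

/-!
# NE7LandauLinearStraight — THE EXACT LINEAR B5-LANDAU STEP ON THE T4 CARRIERS WITH THE STRAIGHT DATUM (brick T2 of ROAD v4): for a periodic direction `Z`
# with flat curls `≤ B`, STRAIGHT block averages `≤ q` (entrywise on lit-balaban's torus) and sup `≤ b`, the gauge function `σ := n₀·λ₀(∂* z_{ii′})` (assembled
# entry by entry, [B5] (1.25)) is periodic, SKEW when `Z` is skew, of size `‖σ‖ ≤ (d+1)(n₀−1)(card n·b + K n₀ B + K′ q)` (ORDER −1 IN `Z`, k- and N-uniform), and
# `Z − dσ` is EXACTLY in the gauge `(1 − P)∂* = 0` entrywise, keeps the straight averages of `Z`, and has `‖Z − dσ‖ ≤ K·n₀·B + K′·q` (`NE7LandauLinearStraight`)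

Cell `pub-balaban`, lineage `t4-ne7-p1` (CRUX PROVER NE7 #1 = OWNER of row NE7), gen 74; memo `t4/b2b-balaban-t4-ne7-p1-g74/REP-FLAT-ROAD-v4.md` §2–§3.  This is gen 73's
brick D (`NE7SliceSupFlat.entry_letter` ∕ `sliceSup_flat`) WITHOUT the block-constant regauge `g∘blockOf` (which an exact gauge cannot afford) and WITHOUT the
T4-tangency hypothesis, the straight datum `q` entering as an a-priori input (brick T1 `NE7StraightDatumTorus` converts the comb datum of the v2 gauge into it at the
top), over gen 73's intrinsic letter IS (`NE7LandauExactSup.exists_exact_sup_const`) and B1's identities (`NE7LandauLinearSup.residual_landau ∕ Fs_landau ∕ QvOp_landau`).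
THE (−1)-DOOR (memo §2): `λ₀ = Δ⁻¹(1 − PcT)∂*z` has `Q′λ₀ = 0` (`B5Value126.QsOp_lambda0`) and in-block steps `n₀⁻¹(z − z₂)`, so the block-mean-zero Poincaré letter
(`NE7BlockMeanZeroSup.norm_le_of_blockMean_zero`) bounds `n₀λ₀` by `(d+1)(n₀−1)(|z| + |z₂|)` — the gauge function of the step is `O(n₀·‖Z‖)`, not `O(n₀²·‖∂*Z‖)`.
SKEWNESS (§1): `λ₀` commutes with complex conjugation (`lambda0_star`, by the uniqueness `B5Substitution125.lambda0_eq` of the solution of (1.25)), the entries of a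
skew `Z` are `z_{i′i} = −conj z_{ii′}`, hence `σᴴ = −σ` and `e^{σ}` is unitary — needed because the gauge condition must hold EXACTLY after a UNITARY gauge step.
CONTENT ([folklore]; 0 def, 0 sorry; dimension `d + 1`, block side `n₀ ≥ 1`, period `n₀·N`, `N ≥ 1`).  §1 torus letters (`norm_QvAdj_mulVec_le`, the `star` commutations,
`lambda0_star`); §2 `entry_step` (one entry); §3 **`landauLinear_straight`** (the step on the T4 carriers).
HONEST FRAMING (page 1): LINEAR, flat background, abelian entry by entry; constants existential through GAN24's `C(d)`; [B5] (1.18)∕(1.25)∕(1.26)∕(1.69) and [B8] (1.36)∕(1.38)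
are TEXT LOCATIONS, nothing printed is asserted; the NONLINEAR top step (T4), REP♭ and (APE) are NOT proved here; NE7 NOT PRINTED ∕ NOT PROVED (0∕1); spine PROVED 0∕9;
rung (B)+1 finite T⁴ — NOT infinite volume, NOT mass gap, NOT BetaPertH, NOT Clay.  PLACEMENT: our lemma, under `Summits/QuantumFields/BalabanUV/`.
Continuum YM on T⁴ ⇐ BetaPertH ∧ nine spine estimates (0/9 proved); BetaPertH ⇐ (D1) ∧ (D4) ∧ CAP+tail; G-an2-4 gates asym, D1 and NE2/3/4.
-/

set_option autoImplicit false

open scoped BigOperators Matrix ComplexConjugate Matrix.Norms.L2Operator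
open Finset

namespace Summit.QuantumFields.BalabanUV.T4Continuum.NE7LandauLinearStraight

open Literature.MathematicalPhysics.QuantumFieldTheory.Balaban1983to89
open B7Prop1Explicit (Site e e_apply)
open T4AveragingDeficitWall (curlAt IsSkewDir)
open AveragingDeficitPeriodicCounting (IsPeriodicDir)
open B5Prop11Plancherel (Tor fine unitVec)
open B5Action121 (Fs GradOp GradOp_mulVec sdiff_mulVec LapS LapS_mulVec GradOp_conjTranspose_mulVec_eq divS_apply)
open B5Block118 (QvOp QsOp QsOp_mulVec bpt)
open B5DeltaA169 (QvAdj QvAdj_mulVec)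
open B5Prop11G0Torus (qent qent_colsum QvOp_eq_qent)
open B5Substitution125 (lambda0_eq)
open B5Value126 (PcT lambda0 omega0 QsOp_lambda0 sum_lambda0 eq125_lambda0)
open B5Adjoint130 (QsOp_adjoint_mulVec)
open B5DivOrth (sum_GradOp_adjoint)
open B6LowerBound2153Torus (toT rep toT_rep)
open BlockAveragePushDirSplit (flat)
open NE7TorusBoxDictionary (curlAt_flat_entry_torus toT_add_e' apply_rep_toT')
open NE7SliceGreenTestField (toT_add_period)
open NE7FlatHkOrthogonal (Fs_eq_mul_Fs_one entry_eq_neg_conj_of_skew)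
open NE7FlatHkCurlLetter (opNorm_le_card_mul)
open NE7BlockMeanZeroSup (norm_le_of_blockMean_zero bpt_update_succ)
open NE7LandauLinearSup (residual_landau Fs_landau QvOp_landau)
open NE7LandauExactSup (exists_exact_sup_const)
open Literature.Computability.QuantumComplexity.SolovayKitaev (norm_apply_le_norm)

noncomputable section

variable {d : ℕ} {n : Type*} [Fintype n] [DecidableEq n]

/-! ## §1 Torus letters: the lift `Q*` is a contraction in sup; `Δ`, `Q′`, `Q′ᴴ`, `∂*` and `λ₀` commute with complex conjugation -/

section Torus

variable (m : ℕ) [NeZero m] (M : Fin (d + 1) → ℕ) [∀ μ, NeZero (M μ)]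

/-- `|(Q*v)(i)| ≤ sup|v|`: the lift `Q* = η^{−d}Qᴴ` averages `v` over the coarse bonds whose lines pass through `i` (`Σ_b q(b;i) = η^d`, `q ≥ 0`). [folklore] -/
theorem norm_QvAdj_mulVec_le (v : Tor M × Fin (d + 1) → ℂ) {q : ℝ} (hv : ∀ b, ‖v b‖ ≤ q) (i : Tor (fine m M) × Fin (d + 1)) :
    ‖(QvAdj m M *ᵥ v) i‖ ≤ q := by
  have hq0 : 0 ≤ q := (norm_nonneg _).trans (hv ((fun _ => 0), 0))
  have hmr : (0 : ℝ) < (m : ℝ) ^ (d + 1) := by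
    have : (0 : ℝ) < m := by exact_mod_cast Nat.pos_of_ne_zero (NeZero.ne m)
    positivity
  have hqn : ∀ b, 0 ≤ qent m M b i := fun b => by
    unfold qent
    split_ifs
    · exact sum_nonneg fun _ _ => sum_nonneg fun _ _ => by positivity
    · exact le_rfl
  rw [QvAdj_mulVec, Pi.smul_apply, smul_eq_mul, norm_mul]
  simp only [Matrix.mulVec, dotProduct, Matrix.conjTranspose_apply, QvOp_eq_qent, Complex.star_def, Complex.conj_ofReal]
  have h1 : ‖∑ b, ((qent m M b i : ℝ) : ℂ) * v b‖ ≤ ∑ b, qent m M b i * q := by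
    refine (norm_sum_le _ _).trans (sum_le_sum fun b _ => ?_)
    rw [norm_mul, Complex.norm_real, Real.norm_of_nonneg (hqn b)]
    exact mul_le_mul_of_nonneg_left (hv b) (hqn b)
  rw [← sum_mul, qent_colsum] at h1
  have hn : ‖((m : ℂ) ^ (d + 1))‖ = (m : ℝ) ^ (d + 1) := by rw [norm_pow, Complex.norm_natCast]
  rw [hn]
  calc (m : ℝ) ^ (d + 1) * ‖∑ b, ((qent m M b i : ℝ) : ℂ) * v b‖ ≤ (m : ℝ) ^ (d + 1) * (1 / (m : ℝ) ^ (d + 1) * q) :=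
        mul_le_mul_of_nonneg_left h1 hmr.le
    _ = q := by field_simp

/-- `Δ(star f) = star (Δ f)` (any lattice constant `c`: the weights `conj c·c` are real). [folklore] -/
theorem LapS_mulVec_star (c : ℂ) (f : Tor (fine m M) → ℂ) : LapS (fine m M) c *ᵥ star f = star (LapS (fine m M) c *ᵥ f) := by
  funext x
  rw [Pi.star_apply, LapS_mulVec, LapS_mulVec, star_sum]
  refine sum_congr rfl fun ν _ => ?_
  simp only [Pi.star_apply, star_mul', star_sub, Complex.star_def, Complex.conj_conj, map_ofNat]
  ring

/-- `Q′(star f) = star (Q′ f)`. [folklore] -/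
theorem QsOp_mulVec_star (f : Tor (fine m M) → ℂ) : QsOp m M *ᵥ star f = star (QsOp m M *ᵥ f) := by
  funext y
  rw [Pi.star_apply, QsOp_mulVec, QsOp_mulVec, star_mul', star_sum]
  simp only [Pi.star_apply, Complex.star_def, map_div₀, map_one, map_pow, Complex.conj_natCast]

/-- `Q′ᴴ(star ω) = star (Q′ᴴ ω)`. [folklore] -/
theorem QsOp_adjoint_mulVec_star (ω : Tor M → ℂ) : (QsOp m M)ᴴ *ᵥ star ω = star ((QsOp m M)ᴴ *ᵥ ω) := by
  funext x
  rw [Pi.star_apply, QsOp_adjoint_mulVec, QsOp_adjoint_mulVec, star_mul']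
  simp only [Pi.star_apply, Complex.star_def, map_div₀, map_one, map_pow, Complex.conj_natCast]

/-- `∂*(star z) = star (∂* z)` for the REAL lattice constant `c = m`. [folklore] -/
theorem GradOp_adjoint_mulVec_star (z : Tor (fine m M) × Fin (d + 1) → ℂ) :
    (GradOp (fine m M) (m : ℂ))ᴴ *ᵥ star z = star ((GradOp (fine m M) (m : ℂ))ᴴ *ᵥ z) := by
  funext x
  rw [Pi.star_apply, GradOp_conjTranspose_mulVec_eq, GradOp_conjTranspose_mulVec_eq, divS_apply, divS_apply, star_sum]
  refine sum_congr rfl fun μ _ => ?_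
  simp only [Pi.star_apply, star_mul', star_sub, Complex.star_def, Complex.conj_natCast]

/-- **`λ₀` COMMUTES WITH COMPLEX CONJUGATION** (real lattice constant `c = m`, `b ⊥ 1`): `λ₀(star b) = star (λ₀ b)` — `star λ₀(b)` solves (1.25) for `star b` with
`star ω₀`, is `⊥ 1` and in `ker Q′`, so it is THE solution (`B5Substitution125.lambda0_eq`). [folklore] -/
theorem lambda0_star (b : Tor (fine m M) → ℂ) (hb : ∑ x, b x = 0) :
    lambda0 m M (m : ℂ) (star b) = star (lambda0 m M (m : ℂ) b) := by
  have hc : (m : ℂ) ≠ 0 := by exact_mod_cast NeZero.ne m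
  have hbs : ∑ x, (star b) x = 0 := by
    simp only [Pi.star_apply]; rw [← star_sum, hb, star_zero]
  have hlam : ∑ x, (star (lambda0 m M (m : ℂ) b)) x = 0 := by
    simp only [Pi.star_apply]; rw [← star_sum, sum_lambda0, star_zero]
  have h2nd : QsOp m M *ᵥ star (lambda0 m M (m : ℂ) b) = 0 := by
    rw [QsOp_mulVec_star, QsOp_lambda0 m M (m : ℂ) hc, star_zero]
  have h125 : LapS (fine m M) (m : ℂ) *ᵥ (LapS (fine m M) (m : ℂ) *ᵥ star (lambda0 m M (m : ℂ) b)) - LapS (fine m M) (m : ℂ) *ᵥ star b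
      + (QsOp m M)ᴴ *ᵥ star (omega0 m M (m : ℂ) b) = 0 := by
    rw [LapS_mulVec_star, LapS_mulVec_star, LapS_mulVec_star, QsOp_adjoint_mulVec_star, ← star_sub, ← star_add, eq125_lambda0 m M (m : ℂ) hc b hb,
      star_zero]
  have h := lambda0_eq m M (m : ℂ) hc (star (lambda0 m M (m : ℂ) b)) (star b) (star (omega0 m M (m : ℂ) b)) hlam hbs h125 h2nd
  -- `h : star λ₀(b) = (the λ₀ formula at star b)`; the right-hand side is `lambda0 m M m (star b)` by definition
  rw [h]
  rfl

end Torus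

/-! ## §2 One entry -/

/-- **ONE ENTRY: THE LINEAR B5-LANDAU TRANSFORM WITH STRAIGHT DATUM** (`n₀` = block side, coarse torus `(N,…,N)`): given the letter constants `C, C′` of IS, for the torus
restriction `z` of the entry `(i,i′)` of a `(n₀N)`-periodic `Z` with flat curls `≤ B` and straight averages `|Q_k z| ≤ q`, sup `≤ b`, the function
`s := λ₀(∂* z)` (`∂*` with lattice constant `n₀`) satisfies: `(1 − P)∂*(z − ∂s) = 0`; `Q_k(z − ∂s) = Q_k z`; `|(z − ∂s)(p)| ≤ C·(n₀B) + C′·q`;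
`|n₀·s(t)| ≤ (d+1)(n₀−1)·(b + C·(n₀B) + C′·q)`. [folklore] -/
theorem entry_step {C C' : ℝ} (hC : 0 < C) (hC' : 0 < C')
    (hIS : ∀ (m : ℕ) [NeZero m] (M : Fin (d + 1) → ℕ) [∀ μ, NeZero (M μ)] (z : Tor (fine m M) × Fin (d + 1) → ℂ),
      (1 - PcT m M (m : ℂ)) *ᵥ ((GradOp (fine m M) (m : ℂ))ᴴ *ᵥ z) = 0 →
      ∀ B : ℝ, (∀ (μ ν : Fin (d + 1)) (t : Tor (fine m M)), ‖Fs (fine m M) (m : ℂ) z μ ν t‖ ≤ B) →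
      ∀ B' : ℝ, (∀ j, ‖((QvAdj m M * QvOp m M) *ᵥ z) j‖ ≤ B') → ∀ i : Tor (fine m M) × Fin (d + 1), ‖z i‖ ≤ C * B + C' * B')
    (n₀ N : ℕ) [NeZero n₀] [NeZero N]
    {Z : Site (d + 1) → Fin (d + 1) → Matrix n n ℂ} (hZP : IsPeriodicDir Z ((n₀ * N : ℕ) : ℤ))
    {B : ℝ} (hB : ∀ (x : Site (d + 1)) (μ ν : Fin (d + 1)), ‖curlAt (flat (d := d + 1) (n := n)) Z x μ ν‖ ≤ B)
    {b : ℝ} (hb : ∀ (y : Site (d + 1)) (κ : Fin (d + 1)), ‖Z y κ‖ ≤ b) (i i' : n)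
    {q : ℝ} (hq : ∀ (t : Tor (fun _ : Fin (d + 1) => N)) (κ : Fin (d + 1)),
      ‖(QvOp n₀ (fun _ : Fin (d + 1) => N) *ᵥ fun p : Tor (fine n₀ (fun _ : Fin (d + 1) => N)) × Fin (d + 1) =>
        Z (rep (fine n₀ (fun _ : Fin (d + 1) => N)) p.1) p.2 i i') (t, κ)‖ ≤ q) :
    let z : Tor (fine n₀ (fun _ : Fin (d + 1) => N)) × Fin (d + 1) → ℂ := fun p => Z (rep (fine n₀ (fun _ : Fin (d + 1) => N)) p.1) p.2 i i'
    let s : Tor (fine n₀ (fun _ : Fin (d + 1) => N)) → ℂ :=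
      lambda0 n₀ (fun _ : Fin (d + 1) => N) (n₀ : ℂ) ((GradOp (fine n₀ (fun _ : Fin (d + 1) => N)) (n₀ : ℂ))ᴴ *ᵥ z)
    (1 - PcT n₀ (fun _ : Fin (d + 1) => N) (n₀ : ℂ)) *ᵥ ((GradOp (fine n₀ (fun _ : Fin (d + 1) => N)) (n₀ : ℂ))ᴴ *ᵥ
        (z - GradOp (fine n₀ (fun _ : Fin (d + 1) => N)) (n₀ : ℂ) *ᵥ s)) = 0 ∧
    QvOp n₀ (fun _ : Fin (d + 1) => N) *ᵥ (z - GradOp (fine n₀ (fun _ : Fin (d + 1) => N)) (n₀ : ℂ) *ᵥ s)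
      = QvOp n₀ (fun _ : Fin (d + 1) => N) *ᵥ z ∧
    (∀ p, ‖(z - GradOp (fine n₀ (fun _ : Fin (d + 1) => N)) (n₀ : ℂ) *ᵥ s) p‖ ≤ C * ((n₀ : ℝ) * B) + C' * q) ∧
    (∀ t, ‖(n₀ : ℂ) * s t‖ ≤ ((d + 1 : ℕ) : ℝ) * ((n₀ : ℝ) - 1) * (b + (C * ((n₀ : ℝ) * B) + C' * q))) := by
  intro z s
  have hnz : (n₀ : ℂ) ≠ 0 := by exact_mod_cast NeZero.ne n₀
  have hn0 : (0 : ℝ) < n₀ := by exact_mod_cast Nat.pos_of_ne_zero (NeZero.ne n₀)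
  have hB0 : 0 ≤ B := (norm_nonneg _).trans (hB 0 0 0)
  have hb0 : 0 ≤ b := (norm_nonneg _).trans (hb 0 0)
  set z₂ := z - GradOp (fine n₀ (fun _ : Fin (d + 1) => N)) (n₀ : ℂ) *ᵥ s with hz₂
  -- (a) exact gauge, straight datum, plaquettes: B1's identities
  have hgauge : (1 - PcT n₀ (fun _ : Fin (d + 1) => N) (n₀ : ℂ)) *ᵥ ((GradOp (fine n₀ (fun _ : Fin (d + 1) => N)) (n₀ : ℂ))ᴴ *ᵥ z₂) = 0 :=
    residual_landau n₀ (fun _ : Fin (d + 1) => N) z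
  have hQ : QvOp n₀ (fun _ : Fin (d + 1) => N) *ᵥ z₂ = QvOp n₀ (fun _ : Fin (d + 1) => N) *ᵥ z := QvOp_landau n₀ (fun _ : Fin (d + 1) => N) z
  have hFs : ∀ (μ ν : Fin (d + 1)) (t : Tor (fine n₀ (fun _ : Fin (d + 1) => N))),
      ‖Fs (fine n₀ (fun _ : Fin (d + 1) => N)) (n₀ : ℂ) z₂ μ ν t‖ ≤ (n₀ : ℝ) * B := by
    intro μ ν t
    rw [hz₂, Fs_landau, Fs_eq_mul_Fs_one _ ((n₀ : ℂ)), norm_mul, Complex.norm_natCast]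
    refine mul_le_mul_of_nonneg_left ?_ (Nat.cast_nonneg _)
    have h := curlAt_flat_entry_torus (P := n₀ * N) hZP (rep (fine n₀ (fun _ : Fin (d + 1) => N)) t) μ ν i i'
    rw [toT_rep] at h
    rw [← h]
    exact (norm_apply_le_norm _ i i').trans (hB _ μ ν)
  have hB' : ∀ j, ‖((QvAdj n₀ (fun _ : Fin (d + 1) => N) * QvOp n₀ (fun _ : Fin (d + 1) => N)) *ᵥ z₂) j‖ ≤ q := by
    intro j
    rw [← Matrix.mulVec_mulVec, hQ]
    exact norm_QvAdj_mulVec_le n₀ (fun _ : Fin (d + 1) => N) _ (fun b => hq b.1 b.2) j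
  -- (b) IS
  have h2 : ∀ p, ‖z₂ p‖ ≤ C * ((n₀ : ℝ) * B) + C' * q := fun p => hIS n₀ (fun _ : Fin (d + 1) => N) z₂ hgauge _ hFs _ hB' p
  refine ⟨hgauge, hQ, h2, fun t => ?_⟩
  -- (c) the (−1)-door: `Q′s = 0` and the in-block steps of `s` are `n₀⁻¹(z − z₂)`
  have hstep : ∀ (y : Tor (fun _ : Fin (d + 1) => N)) (j : Fin (d + 1) → Fin n₀) (ν : Fin (d + 1)) (h : (j ν : ℕ) + 1 < n₀),
      ‖s (bpt n₀ (fun _ : Fin (d + 1) => N) y (Function.update j ν ⟨(j ν : ℕ) + 1, h⟩)) - s (bpt n₀ (fun _ : Fin (d + 1) => N) y j)‖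
        ≤ ((n₀ : ℝ))⁻¹ * (b + (C * ((n₀ : ℝ) * B) + C' * q)) := by
    intro y j ν h
    set t₀ := bpt n₀ (fun _ : Fin (d + 1) => N) y j with ht₀
    rw [bpt_update_succ, ← ht₀]
    have hid : (n₀ : ℂ) * (s (t₀ + unitVec (fine n₀ (fun _ : Fin (d + 1) => N)) ν) - s t₀) = z (t₀, ν) - z₂ (t₀, ν) := by
      rw [hz₂, Pi.sub_apply, GradOp_mulVec, sdiff_mulVec]; ring
    have hnorm : (n₀ : ℝ) * ‖s (t₀ + unitVec (fine n₀ (fun _ : Fin (d + 1) => N)) ν) - s t₀‖ ≤ b + (C * ((n₀ : ℝ) * B) + C' * q) := by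
      have h := congrArg (fun w : ℂ => ‖w‖) hid
      simp only [norm_mul, Complex.norm_natCast] at h
      rw [h]
      exact (norm_sub_le _ _).trans (add_le_add ((norm_apply_le_norm _ i i').trans (hb _ ν)) (h2 (t₀, ν)))
    exact (le_inv_mul_iff₀ hn0).mpr hnorm
  have hQ0 : QsOp n₀ (fun _ : Fin (d + 1) => N) *ᵥ s = 0 := QsOp_lambda0 _ _ _ hnz _
  have hg0 : 0 ≤ ((n₀ : ℝ))⁻¹ * (b + (C * ((n₀ : ℝ) * B) + C' * q)) := by
    have hq0 : 0 ≤ q := (norm_nonneg _).trans (hq 0 0)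
    positivity
  have hs := norm_le_of_blockMean_zero n₀ (fun _ : Fin (d + 1) => N) s hQ0 hg0 hstep t
  rw [norm_mul, Complex.norm_natCast]
  calc (n₀ : ℝ) * ‖s t‖ ≤ (n₀ : ℝ) * (((d + 1 : ℕ) : ℝ) * ((n₀ : ℝ) - 1) * (((n₀ : ℝ))⁻¹ * (b + (C * ((n₀ : ℝ) * B) + C' * q)))) :=
        mul_le_mul_of_nonneg_left hs (Nat.cast_nonneg _)
    _ = ((d + 1 : ℕ) : ℝ) * ((n₀ : ℝ) - 1) * (b + (C * ((n₀ : ℝ) * B) + C' * q)) := by field_simp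

/-! ## §3 THE STEP on the T4 carriers -/

/-- **THE EXACT LINEAR B5-LANDAU STEP WITH STRAIGHT DATUM** (dimension `d + 1`): there are `K, K′ > 0` (functions of `d`, `card n`) such that for every block side `n₀ ≥ 1`,
every `N ≥ 1`, every `(n₀N)`-periodic `Z` with `‖curlAt 1 Z‖ ≤ B`, straight averages `|Q_k z_{ii′}| ≤ q` (every entry) and `‖Z‖ ≤ b`, there is `σ : Site → Matrix n n ℂ`,
`(n₀N)`-periodic, SKEW if `Z` is skew, with: every entry of `Z − dσ` read on the torus EXACTLY in the gauge `(1 − P)∂* = 0` and with the straight averages of `Z`;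
**`‖Z(y,κ) − (σ(y+e_κ) − σ(y))‖ ≤ K·n₀·B + K′·q`**; **`‖σ(y)‖ ≤ (d+1)(n₀−1)·(card n·b + K·n₀·B + K′·q)`**. [folklore] -/
theorem landauLinear_straight [Nonempty n] :
    ∃ K K' : ℝ, 0 < K ∧ 0 < K' ∧ ∀ (n₀ N : ℕ) [NeZero n₀] [NeZero N]
      (Z : Site (d + 1) → Fin (d + 1) → Matrix n n ℂ), IsPeriodicDir Z ((n₀ * N : ℕ) : ℤ) →
      ∀ (B : ℝ), (∀ (x : Site (d + 1)) (μ ν : Fin (d + 1)), ‖curlAt (flat (d := d + 1) (n := n)) Z x μ ν‖ ≤ B) →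
      ∀ (q : ℝ), (∀ (i i' : n) (t : Tor (fun _ : Fin (d + 1) => N)) (κ : Fin (d + 1)),
        ‖(QvOp n₀ (fun _ : Fin (d + 1) => N) *ᵥ fun p : Tor (fine n₀ (fun _ : Fin (d + 1) => N)) × Fin (d + 1) =>
          Z (rep (fine n₀ (fun _ : Fin (d + 1) => N)) p.1) p.2 i i') (t, κ)‖ ≤ q) →
      ∀ (b : ℝ), (∀ (y : Site (d + 1)) (κ : Fin (d + 1)), ‖Z y κ‖ ≤ b) →
      ∃ σ : Site (d + 1) → Matrix n n ℂ,
        (∀ (y : Site (d + 1)) (ι : Fin (d + 1)), σ (y + ((n₀ * N : ℕ) : ℤ) • e ι) = σ y) ∧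
        (IsSkewDir Z → ∀ y : Site (d + 1), σ y ∈ skewAdjoint (Matrix n n ℂ)) ∧
        (∀ i i' : n, (1 - PcT n₀ (fun _ : Fin (d + 1) => N) (n₀ : ℂ)) *ᵥ ((GradOp (fine n₀ (fun _ : Fin (d + 1) => N)) (n₀ : ℂ))ᴴ *ᵥ
          fun p : Tor (fine n₀ (fun _ : Fin (d + 1) => N)) × Fin (d + 1) =>
            (Z (rep (fine n₀ (fun _ : Fin (d + 1) => N)) p.1) p.2
              - (σ (rep (fine n₀ (fun _ : Fin (d + 1) => N)) p.1 + e p.2) - σ (rep (fine n₀ (fun _ : Fin (d + 1) => N)) p.1))) i i') = 0) ∧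
        (∀ (i i' : n) (t : Tor (fun _ : Fin (d + 1) => N)) (κ : Fin (d + 1)),
          (QvOp n₀ (fun _ : Fin (d + 1) => N) *ᵥ fun p : Tor (fine n₀ (fun _ : Fin (d + 1) => N)) × Fin (d + 1) =>
            (Z (rep (fine n₀ (fun _ : Fin (d + 1) => N)) p.1) p.2
              - (σ (rep (fine n₀ (fun _ : Fin (d + 1) => N)) p.1 + e p.2) - σ (rep (fine n₀ (fun _ : Fin (d + 1) => N)) p.1))) i i') (t, κ)
          = (QvOp n₀ (fun _ : Fin (d + 1) => N) *ᵥ fun p : Tor (fine n₀ (fun _ : Fin (d + 1) => N)) × Fin (d + 1) =>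
            Z (rep (fine n₀ (fun _ : Fin (d + 1) => N)) p.1) p.2 i i') (t, κ)) ∧
        (∀ (y : Site (d + 1)) (κ : Fin (d + 1)), ‖Z y κ - (σ (y + e κ) - σ y)‖ ≤ K * (n₀ : ℝ) * B + K' * q) ∧
        (∀ y : Site (d + 1), ‖σ y‖ ≤ ((d + 1 : ℕ) : ℝ) * ((n₀ : ℝ) - 1) * (Fintype.card n * b + K * (n₀ : ℝ) * B + K' * q)) := by
  obtain ⟨C, C', hC, hC', hIS⟩ := exists_exact_sup_const (d := d)
  refine ⟨Fintype.card n * C, Fintype.card n * C', by positivity, by positivity, fun n₀ N _ _ Z hZP B hB q hq b hb => ?_⟩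
  haveI : NeZero (n₀ * N) := ⟨Nat.mul_ne_zero (NeZero.ne n₀) (NeZero.ne N)⟩
  -- abbreviations: the fine torus, the torus restriction of an entry, the Landau potential of an entry
  set T : Fin (d + 1) → ℕ := fine n₀ (fun _ : Fin (d + 1) => N) with hT
  set z : n → n → (Tor T × Fin (d + 1) → ℂ) := fun i i' p => Z (rep T p.1) p.2 i i' with hz
  set s : n → n → (Tor T → ℂ) := fun i i' => lambda0 n₀ (fun _ : Fin (d + 1) => N) (n₀ : ℂ) ((GradOp T (n₀ : ℂ))ᴴ *ᵥ z i i') with hs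
  have key := fun i i' => entry_step (n := n) hC hC' hIS n₀ N hZP hB hb i i' (hq i i')
  -- the gauge function
  refine ⟨fun y => Matrix.of fun i i' => (n₀ : ℂ) * s i i' (toT T y), fun y ι => ?_, fun hZs y => ?_, fun i i' => ?_, fun i i' t κ => ?_,
    fun y κ => ?_, fun y => ?_⟩
  · -- periodicity
    ext i i'
    simp only [Matrix.of_apply]
    rw [show toT T (y + ((n₀ * N : ℕ) : ℤ) • e ι) = toT T y from toT_add_period (d := d + 1) (n₀ * N) y ι]
  · -- skewness: `s_{i′i} = −star ∘ s_{ii′}` by `lambda0_star`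
    rw [skewAdjoint.mem_iff]
    ext i i'
    simp only [Matrix.star_apply, Matrix.of_apply, Matrix.neg_apply]
    have hzz : z i' i = -star (z i i') := by
      funext p
      simp only [hz, Pi.neg_apply, Pi.star_apply, RCLike.star_def]
      exact entry_eq_neg_conj_of_skew (hZs (rep T p.1) p.2) i' i
    have hss : s i' i = -star (s i i') := by
      simp only [hs]
      rw [hzz, Matrix.mulVec_neg, ← sub_zero (-( (GradOp T (n₀ : ℂ))ᴴ *ᵥ star (z i i'))), ← zero_sub, show (0 : Tor T → ℂ) - _ - 0 = -((GradOp T (n₀ : ℂ))ᴴ *ᵥ star (z i i')) by abel]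
      rw [GradOp_adjoint_mulVec_star]
      have hlin : ∀ w : Tor T → ℂ, lambda0 n₀ (fun _ : Fin (d + 1) => N) (n₀ : ℂ) (-w) = -lambda0 n₀ (fun _ : Fin (d + 1) => N) (n₀ : ℂ) w := by
        intro w
        simp only [B5Value126.lambda0_eq_LapSinv, Matrix.mulVec_neg]
      rw [hlin, lambda0_star n₀ (fun _ : Fin (d + 1) => N) _ (sum_GradOp_adjoint T (n₀ : ℂ) (z i i'))]
    simp only [hss, Pi.neg_apply, Pi.star_apply, RCLike.star_def, map_mul, map_neg, Complex.conj_conj, Complex.conj_natCast, mul_neg]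
  · -- exact gauge of the entry `(i,i′)` of `Z − dσ`
    have hfun : (fun p : Tor T × Fin (d + 1) => (Z (rep T p.1) p.2
          - ((Matrix.of fun i i' => (n₀ : ℂ) * s i i' (toT T (rep T p.1 + e p.2))) - Matrix.of fun i i' => (n₀ : ℂ) * s i i' (toT T (rep T p.1)))) i i')
        = z i i' - GradOp T (n₀ : ℂ) *ᵥ s i i' := by
      funext p
      simp only [hz, Matrix.sub_apply, Matrix.of_apply, Pi.sub_apply]
      rw [toT_add_e', toT_rep, show GradOp T (n₀ : ℂ) *ᵥ s i i' = fun r => (GradOp T (n₀ : ℂ) *ᵥ s i i') (r.1, r.2) from rfl]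
      simp only [GradOp_mulVec, sdiff_mulVec]
      ring
    rw [hfun]
    exact (key i i').1
  · -- straight datum unchanged
    have hfun : (fun p : Tor T × Fin (d + 1) => (Z (rep T p.1) p.2
          - ((Matrix.of fun i i' => (n₀ : ℂ) * s i i' (toT T (rep T p.1 + e p.2))) - Matrix.of fun i i' => (n₀ : ℂ) * s i i' (toT T (rep T p.1)))) i i')
        = z i i' - GradOp T (n₀ : ℂ) *ᵥ s i i' := by
      funext p
      simp only [hz, Matrix.sub_apply, Matrix.of_apply, Pi.sub_apply]
      rw [toT_add_e', toT_rep, show GradOp T (n₀ : ℂ) *ᵥ s i i' = fun r => (GradOp T (n₀ : ℂ) *ᵥ s i i') (r.1, r.2) from rfl]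
      simp only [GradOp_mulVec, sdiff_mulVec]
      ring
    rw [hfun]
    exact congrFun (key i i').2.1 (t, κ)
  · -- the gauged field, entry by entry
    have hent : ∀ i i', ‖(Z y κ - ((Matrix.of fun i i' => (n₀ : ℂ) * s i i' (toT T (y + e κ))) - Matrix.of fun i i' => (n₀ : ℂ) * s i i' (toT T y))) i i'‖
        ≤ C * ((n₀ : ℝ) * B) + C' * q := by
      intro i i'
      have h := (key i i').2.2.1 (toT T y, κ)
      simp only [Pi.sub_apply, GradOp_mulVec, sdiff_mulVec] at h
      rw [apply_rep_toT' (P := n₀ * N) hZP y κ] at h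
      simp only [Matrix.sub_apply, Matrix.of_apply]
      rw [toT_add_e', ← mul_sub]
      exact h
    calc _ ≤ Fintype.card n * (C * ((n₀ : ℝ) * B) + C' * q) := opNorm_le_card_mul _ hent
      _ = Fintype.card n * C * (n₀ : ℝ) * B + Fintype.card n * C' * q := by ring
  · -- the sup of the gauge function
    have hent : ∀ i i', ‖(Matrix.of fun i i' => (n₀ : ℂ) * s i i' (toT T y)) i i'‖
        ≤ ((d + 1 : ℕ) : ℝ) * ((n₀ : ℝ) - 1) * (b + (C * ((n₀ : ℝ) * B) + C' * q)) := by
      intro i i'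
      simpa only [Matrix.of_apply] using (key i i').2.2.2 (toT T y)
    exact (opNorm_le_card_mul _ hent).trans (le_of_eq (by ring))

end

end Summit.QuantumFields.BalabanUV.T4Continuum.NE7LandauLinearStraight
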